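import Mathlib
import HarnessLib
import Summits.ValiantsHypothesis.ValiantsHypothesis.Statement
import Summits.ValiantsHypothesis.ValiantsHypothesis.Theses.MonotoneRestoration
import Summits.ValiantsHypothesis.ValiantsHypothesis.Theorems.OrbitRestorationLinearVolumeQP.Negative.OrbitRestorationLinearVolumeQPFalseOfLinearVolumePolylogWidthVP

/-!
# R1 (`OrbitRestorationLinearVolumeQP`, stmt-ValiantsHypothesis-18294) is VH-STRENGTH over any
# linear-volume pattern family with p-definable, polylog-separating homomorphism polynomials

Route MonotoneRestoration, aside R1 (line `birth`; rests on `stub_lvNarrowSpan` after K2/K3).  The line's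
registration note records the planner's FINDING `valiantsHypothesis_of_linearVolume : LinearVolumeHomCFI →
OrbitRestorationLinearVolumeQP → ValiantsHypothesis` — R1, filed as the route's "VH-free positive re-target", is in
fact VH-strength modulo a separation theorem in print.  This file puts that finding into the Theorems tree in
EXPLICIT-HYPOTHESIS form (no named fact, no literature debt): for ANY bipartite pattern family
`F_n = (Fin (a n) ⊔ Fin (b n), E n)` of linear volume whose homomorphism polynomials

* form a `VNP` family (`IsVNPFamily`; true for every pattern family of polynomial size — homomorphism
  polynomials are p-definable, Dwivedi–Pago–Seppelt 2026 §2 — not formalised here), and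
* are POLYLOG-SEPARATING on `0/1` adjacency matrices (beyond every order two
  `≡^{C^{(log₂ m + c)^c}}`-equivalent graphs with different `hom(F_m, ·)`; in print for 2-subdivided bounded-degree
  expanders via the Cai–Fürer–Immerman graphs over them: `C^k`-equivalence below the treewidth of the base,
  linear treewidth of expanders, and `hom(F, ·)` separating the CFI pair over `F` — Roberson 2022; Neuen 2024;
  Chen–Flum–Liu 2025, Thms 11.1/12.2 — not formalised here),

`OrbitRestorationLinearVolumeQP` implies `VP ≠ VNP` over `ℂ`:

* `valiantsHypothesis_of_orbitRestorationLinearVolumeQP_of_separatingPattern` — the `m_n = 1` form above;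
* `valiantsHypothesis_of_orbitRestorationLinearVolumeQP_of_separatingCombination` — the same for any family in
  R1's hypothesis class (poly-dimension linear-volume hom combination) that is `VNP` and polylog-separating.

Mechanism: under `VP = VNP` the family is a `VP` family (`mem_VP_ofFintype_iff_holds`,
`mem_VNP_ofFintype_iff_holds`), hence a `LinearVolumePolylogWidthVP` witness
(`linearVolumePolylogWidthVP_of_single`), which refutes R1
(`OrbitRestorationLinearVolumeQP_false_of_LinearVolumePolylogWidthVP`, the tree's PROVED orbit-form
Dawar–Wilsenach pipeline).  Honest framing: a conditional with its two inputs as explicit binders; it shows where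
R1 sits (any proof of R1 plus the two printed inputs is a proof of VP ≠ VNP) and proves nothing about R1, the crux
or VP ≠ VNP.
-/

noncomputable section

-- `Summit.ValiantsHypothesis.ValiantsHypothesis.…` is the tree's single-conjunct layout (Sub = Summit).
set_option linter.dupNamespace false

namespace Summit.ValiantsHypothesis.ValiantsHypothesis.Theorems

namespace OrbitRestorationLinearVolumeQPVHStrength

open Summit.ValiantsHypothesis.ValiantsHypothesis.Theses.MonotoneRestoration
open Literature.Computability.AlgebraicComplexity
open Literature.ModelTheory.FiniteModelTheory

/-- Under `VP = VNP` over `ℂ`, every `VNP` family on the `n × n` matrix is a `VP` family (bundling via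
`PolyFamily.ofFintype`; Bürgisser 2000, Rem. 2.2). [cite: Burgisser2000, Rem. 2.2] -/
theorem isVPFamily_of_isVNPFamily_of_VP_eq_VNP (hEq : VP ℂ = VNP ℂ)
    {f : (n : ℕ) → MvPolynomial (Fin n × Fin n) ℂ} (hf : IsVNPFamily f) : IsVPFamily f := by
  have h : PolyFamily.ofFintype f ∈ VP ℂ := by
    rw [hEq]
    exact (mem_VNP_ofFintype_iff_holds (k := ℂ) f).2 hf
  exact (mem_VP_ofFintype_iff_holds (k := ℂ) f).1 h

/-- **R1 is VH-strength over a separating linear-volume pattern family (`m_n = 1` form).**  Let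
`F_n = (Fin (a n) ⊔ Fin (b n), E n)` be bipartite multigraph patterns with `a n + b n ≤ c (n+1)` whose
homomorphism polynomials `hom_{F_n,n}` form a `VNP` family and are polylog-separating on `0/1` adjacency
matrices.  Then `OrbitRestorationLinearVolumeQP` implies Valiant's hypothesis `VP ≠ VNP` over `ℂ`: under
`VP = VNP` the hom family is a `VP` family in R1's class with one pattern per level, R1 gives it square-symmetric
circuits of quasi-polynomial orbit size, and the orbit-form Dawar–Wilsenach pipeline forbids those for a
polylog-separating family.  (Both inputs hold in print for 2-subdivided bounded-degree expanders; neither is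
formalised here.) [cite: DawarWilsenach2025, Thm 5.1, §6, §7.1; DwivediPagoSeppelt2026, Outlook Q3] -/
theorem valiantsHypothesis_of_orbitRestorationLinearVolumeQP_of_separatingPattern
    (a b : ℕ → ℕ) (E : (n : ℕ) → Multiset (Fin (a n) × Fin (b n))) (c : ℕ)
    (hvol : ∀ n, a n + b n ≤ c * (n + 1))
    (hVNP : IsVNPFamily fun n => homPoly (E n) n ℂ)
    (hsep : ∀ c' N : ℕ, ∃ m : ℕ, N ≤ m ∧ ∃ X Y : SimpleGraph (Fin m),
      CkEquiv ((Nat.log 2 m + c') ^ c') X Y ∧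
        MvPolynomial.eval (Set.indicator {ij : Fin m × Fin m | X.Adj ij.1 ij.2} 1) (homPoly (E m) m ℂ) ≠
          MvPolynomial.eval (Set.indicator {ij : Fin m × Fin m | Y.Adj ij.1 ij.2} 1)
            (homPoly (E m) m ℂ))
    (hR1 : OrbitRestorationLinearVolumeQP) : ValiantsHypothesis := by
  show VP ℂ ≠ VNP ℂ
  intro hEq
  exact OrbitRestorationLinearVolumeQP_false_of_LinearVolumePolylogWidthVP
    (linearVolumePolylogWidthVP_of_single a b E c hvol
      (isVPFamily_of_isVNPFamily_of_VP_eq_VNP hEq hVNP) hsep) hR1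

/-- **R1 is VH-strength over a separating family of its own class (general form).**  If SOME family `f` in
R1's hypothesis class — level by level a combination of `≤ (n+2)^c` homomorphism polynomials of bipartite
patterns with `≤ c (n+1)` vertices — is a `VNP` family and is polylog-separating on `0/1` adjacency matrices,
then `OrbitRestorationLinearVolumeQP` implies `VP ≠ VNP` over `ℂ`.
[cite: DawarWilsenach2025, Thm 5.1, §6, §7.1; DwivediPagoSeppelt2026, Outlook Q3] -/
theorem valiantsHypothesis_of_orbitRestorationLinearVolumeQP_of_separatingCombination
    (f : (n : ℕ) → MvPolynomial (Fin n × Fin n) ℂ) (hVNP : IsVNPFamily f)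
    (hLV : ∃ (c : ℕ) (m : ℕ → ℕ) (a b : (n : ℕ) → Fin (m n) → ℕ)
        (E : (n : ℕ) → (i : Fin (m n)) → Multiset (Fin (a n i) × Fin (b n i)))
        (α : (n : ℕ) → Fin (m n) → ℂ),
      (∀ n, m n ≤ (n + 2) ^ c) ∧ (∀ n i, a n i + b n i ≤ c * (n + 1)) ∧
        ∀ n, f n = ∑ i : Fin (m n), MvPolynomial.C (α n i) * homPoly (E n i) n ℂ)
    (hsep : ∀ c' N : ℕ, ∃ m : ℕ, N ≤ m ∧ ∃ X Y : SimpleGraph (Fin m),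
      CkEquiv ((Nat.log 2 m + c') ^ c') X Y ∧
        MvPolynomial.eval (Set.indicator {ij : Fin m × Fin m | X.Adj ij.1 ij.2} 1) (f m) ≠
          MvPolynomial.eval (Set.indicator {ij : Fin m × Fin m | Y.Adj ij.1 ij.2} 1) (f m))
    (hR1 : OrbitRestorationLinearVolumeQP) : ValiantsHypothesis := by
  show VP ℂ ≠ VNP ℂ
  intro hEq
  exact OrbitRestorationLinearVolumeQP_false_of_LinearVolumePolylogWidthVP
    ⟨f, isVPFamily_of_isVNPFamily_of_VP_eq_VNP hEq hVNP, hLV, hsep⟩ hR1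

end OrbitRestorationLinearVolumeQPVHStrength

end Summit.ValiantsHypothesis.ValiantsHypothesis.Theorems

end
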